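import Summits.QuantumFields.BalabanUV.T4Continuum.Support.NE3CornerSpikes
import Summits.QuantumFields.BalabanUV.T4Continuum.Support.NE3LandauOrbit
import Summits.QuantumFields.BalabanUV.T4Continuum.Support.NE3CurlOfGaugeDir
import HarnessLib

/-!
# Support | NE7 (gen 97, ROAD-G97 §4: THE TOP-CORNER SPIKE DICTIONARY): the gauge direction generated by a spike field of top-corner heights `h` passes through the whole
# averaging tower EXACTLY — `framePotW L (j+1) W (gaugeDir W (spikeW M h)) z = (1 − M^{−d})·h z`, `dirIter L (j+1) W (gaugeDir W (spikeW M h)) = gaugeDir W̄ h`,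
# `QbarIter L (j+1) W (gaugeDir W (spikeW M h)) = gaugeDir W̄ (M^{−d}·h)` (`M = L^{j+1}`, curved unitary `W` in the multi-level small-field class) — and costs
# `Σ‖gaugeDir W (spikeW M h)‖² ≤ 4d·Σ_z‖h z‖²`, `curlSq ≤ 4a²·#Plane·Σ_z‖h z‖²` (NO `M^{d−2}`, NO cross-corner terms)

Cell `pub-balaban`, rung (B)+1 sub-cell t4, lineage `b2b-balaban-t4-ne7-p1` (CRUX PROVER NE7 #1 = OWNER of row NE7), generation 97; memo `t4/b2b-balaban-t4-ne7-p1-g97/ROAD-G97.md` §4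
(ROAD-Γ′, step S3: the residual top frame reading `f = framePotW X₂` of the exactly top-normalised representative is carried by the corner spikes `gaugeDir W (spikeW M f)` inside
`X_N`; this file is the EXACT linear algebra of that step).  Over row NE3's `NE3CornerSpikes` (`spikeW`, `bmeanW_spikeW`, `sum_normSq_gaugeDir_spikeW_le`), `NE3CovariantBlockMean.
framePotW_gaugeDir` (the curved (‡): `framePotW (gaugeDir μ) = μ(corner) − bmeanIterW μ`, EXACT), `NE3TangentCovariantTower.dirIter_gaugeDir`, `NE3LandauOrbit.QbarIter_gaugeDir`,
`NE3CurlOfGaugeDir.curlSq_gaugeDir_le`, and the skeleton arithmetic `SkeletonLattice.cdiv_eq_of_repr` ∕ `cmod_eq_of_repr`.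

WHY (memo ROAD-G97 §§2–4).  The second-order top frame reading `f_z` of the representative cannot be fed to the right inverse (its top pure gauge `gaugeDir_top f` is log-large in
ℓ¹ for the multi-scale corner adversary, memo ROAD-G96 §4∕§7) and cannot be removed by a bump gauge adjustment of radius `~M` without paying `Σ_z‖f_z‖²` at unit weight; a SPIKE
of height `f_z` at each top corner `M•z` has energy `2d·M⁻²·Σ_z‖f_z‖²` in the weighted norm (this file + `energyNormW`), which the corner letters of `NE7AccumulatedFrameDefectCornerSums`
(`Σ_z‖f_z‖² ≤ C·b²·M·‖X‖²`) make k-free.  For the split `X = X_T + X_N` to be EXACT one needs the spike's passage through the tower in closed form: its k-fold linearised average is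
the top gauge direction of `h` (so it cancels `gaugeDir_top f` in `D X`), its accumulated frame reading is `(1 − M^{−d})h` (so the frame-kill defect left for a corner-trivial
D-invisible correction is `M^{−d}f`, negligible), its double-bar average is the top gauge direction of `M^{−d}h`.  All three are EXACT at a curved background because gauge
directions are transported exactly (`dirIter_gaugeDir`, `framePotW_gaugeDir`) and the nested transported block mean of a top-corner spike is `M^{−d}h` (the corner is transported by
the empty word at every level: §1).
WHAT ([folklore]; 0 def, 0 sorry).  §1 `spikeW_smul`, `spikeW_one`, **`spikeW_mul_block`** (`spikeW (L·P) h (L•z + r) = [r = 0]·spikeW P h z`), `bmeanW_spikeW_mul`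
(`bmeanW L W (spikeW (L·P) h) = L^{−d}•spikeW P h`), **`bmeanIterW_spikeW_pow`** (`bmeanIterW L k W (spikeW L^k h) z = (L^{−d})^k • h z`).  §2 `gaugeDir_sub_fun`, `gaugeDir_smul_fun`,
**`framePotW_gaugeDir_spikeW`**, **`dirIter_gaugeDir_spikeW`**, **`QbarIter_gaugeDir_spikeW`** (multi-level small-field class at `W`, `h` skew and `N`-periodic).  §3 the letters:
`dirSq_gaugeDir_spikeW_le` (`≤ 4d·Σ‖h‖²`, row NE3 by name), `curlSq_gaugeDir_spikeW_le` (`≤ 4a²·#Plane·Σ_{z∈[0,N)^d}‖h z‖²` at `SmallField W a`).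
HONEST FRAMING (page 1): exact lattice kinematics on OUR frame over landed kernel theorems; nothing of Bałaban's asserted; the fixed point S2, the split S3, (Γ4), (Γ5), `hdecomp♭`, NE7
NOT proved; spine 0∕9; finite T⁴ rung (B)+1 — NOT infinite volume, NOT mass gap, NOT `BetaPertH`, NOT Clay.  Continuum YM on T⁴ ⇐ BetaPertH ∧ nine spine estimates (0/9 proved);
BetaPertH ⇐ (D1) ∧ (D4) ∧ CAP+tail; G-an2-4 gates asym, D1 and NE2/3/4.
-/

set_option autoImplicit false

open scoped BigOperators Matrix Matrix.Norms.L2Operator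
open NormedSpace Finset

namespace Summit.QuantumFields.BalabanUV.T4Continuum.NE7CornerSpikeTopDictionary

open Literature.MathematicalPhysics.QuantumFieldTheory.Balaban1983to89
open B7Prop1Explicit B7Prop2Explicit
open T4AveragingDeficitWall (Ad IsUnitaryCfg IsSkewDir SmallField curlSq dirSq)
open T4AveragingDeficitWallBoundary (IsPeriodicCfg periodBox)
open AveragingDeficitNearIdentity (Ad_one Ad_zero Ad_smul Ad_add Ad_neg)
open AveragingDeficitMultiLevelPrep (cavgIter LevelSmall tower)
open AveragingDeficitChartCalculus (cavg)
open SkeletonLattice (cdiv cmod smul_cdiv_add_cmod cdiv_eq_of_repr cmod_eq_of_repr cmod_nonneg cmod_lt)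
open BlockAveragePushDirGauge (gaugeDir isPeriodicDir_gaugeDir)
open NE3TangentCovariantTower (dirIter QbarIter framePotW dirIter_gaugeDir)
open NE3CovariantBlockMean (bmeanW bmeanIterW bmeanIterW_zero bmeanIterW_succ framePotW_gaugeDir boxVec_bounds)
open NE3CornerSpikes (spikeW r0 boxVec_r0 boxVec_eq_zero_iff spikeW_corner spikeW_block spikeW_mem_skewAdjoint spikeW_add_period sum_normSq_gaugeDir_spikeW_le
  sum_block_normSq_spikeW)
open NE3BlockLineAverage (sum_periodBox_blocks)
open NE3LandauOrbit (gaugeDir_skew QbarIter_gaugeDir)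
open NE3CurlOfGaugeDir (curlSq_gaugeDir_le)

noncomputable section

variable {d : ℕ} {n : Type*} [Fintype n] [DecidableEq n]

/-! ## §1 Spikes across scales: the nested transported block mean of a top-corner spike -/

omit [Fintype n] [DecidableEq n] in
/-- The spike field is linear in the heights (real scalars). [folklore] -/
theorem spikeW_smul (M : ℕ) (c : ℝ) (h : Site d → Matrix n n ℂ) (y : Site d) :
    spikeW M (fun z => c • h z) y = c • spikeW M h y := by
  unfold spikeW; split_ifs <;> simp

omit [Fintype n] [DecidableEq n] in
/-- At scale `1` every site is a corner: `spikeW 1 h = h`. [folklore] -/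
theorem spikeW_one (h : Site d → Matrix n n ℂ) (y : Site d) : spikeW 1 h y = h y := by
  have hc : cmod 1 y = 0 := funext fun i => by simp [cmod]
  have hd : cdiv 1 y = y := funext fun i => by simp [cdiv]
  unfold spikeW; rw [if_pos hc, hd]

omit [Fintype n] [DecidableEq n] in
/-- **A SPIKE ON THE `L·P`-LATTICE SEEN FROM AN `L`-BLOCK**: for `1 ≤ L`, `1 ≤ P`, `spikeW (L·P) h (L•z + r) = spikeW P h z` at the offset `r = 0` and `0` at every other offset
`r ∈ [0,L)^d` (write `z = P•w + q`, `q ∈ [0,P)^d`; then `L•z + r = (LP)•w + (L•q + r)` with `L•q + r ∈ [0, LP)^d`). [folklore] -/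
theorem spikeW_mul_block {L P : ℕ} (hL : 1 ≤ L) (hP : 1 ≤ P) (h : Site d → Matrix n n ℂ) (z : Site d) (r : Fin d → Fin L) :
    spikeW (L * P) h ((L : ℤ) • z + boxVec L r) = if r = r0 hL then spikeW P h z else 0 := by
  -- the block decomposition of `z` at scale `P` and of `L•z + r` at scale `L·P`
  set w : Site d := cdiv P z with hw
  set q : Site d := cmod P z with hq
  have hz : z = (P : ℤ) • w + q := (smul_cdiv_add_cmod P z).symm
  have hq0 : ∀ i, 0 ≤ q i := fun i => cmod_nonneg hP z i
  have hqP : ∀ i, q i < P := fun i => cmod_lt hP z i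
  have hr0 : ∀ i, 0 ≤ boxVec L r i := fun i => (boxVec_bounds L r i).1
  have hrL : ∀ i, boxVec L r i < L := fun i => (boxVec_bounds L r i).2
  have hx : (L : ℤ) • z + boxVec L r = ((L * P : ℕ) : ℤ) • w + ((L : ℤ) • q + boxVec L r) := by
    rw [hz, smul_add, smul_smul]; push_cast; abel
  have hQ0 : ∀ i, 0 ≤ ((L : ℤ) • q + boxVec L r) i := fun i => by
    simp only [Pi.add_apply, Pi.smul_apply, smul_eq_mul]
    have := hq0 i; have := hr0 i; positivity
  have hQL : ∀ i, ((L : ℤ) • q + boxVec L r) i < ((L * P : ℕ) : ℤ) := fun i => by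
    simp only [Pi.add_apply, Pi.smul_apply, smul_eq_mul]
    have h1 : q i ≤ (P : ℤ) - 1 := by have := hqP i; omega
    have h2 : boxVec L r i ≤ (L : ℤ) - 1 := by have := hrL i; omega
    have hL0 : (0 : ℤ) ≤ L := by positivity
    push_cast; nlinarith
  have hcd : cdiv (L * P) ((L : ℤ) • z + boxVec L r) = w := cdiv_eq_of_repr hx hQ0 hQL
  have hcm : cmod (L * P) ((L : ℤ) • z + boxVec L r) = (L : ℤ) • q + boxVec L r := cmod_eq_of_repr hx hQ0 hQL
  -- the offset vanishes iff `q = 0` and `r = 0`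
  have hL0 : (L : ℤ) ≠ 0 := by exact_mod_cast (by omega : L ≠ 0)
  unfold spikeW
  rw [hcm, hcd]
  by_cases hr : r = r0 hL
  · rw [if_pos hr, hr, boxVec_r0 hL, add_zero]
    have hiff : (L : ℤ) • q = 0 ↔ q = 0 := by
      constructor
      · intro h0; funext i; have := congrFun h0 i
        simp only [Pi.smul_apply, smul_eq_mul, Pi.zero_apply, mul_eq_zero] at this
        exact this.resolve_left hL0
      · intro h0; rw [h0, smul_zero]
    by_cases hq' : q = 0
    · rw [if_pos (hiff.2 hq'), if_pos hq']
    · rw [if_neg (mt hiff.1 hq'), if_neg hq']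
  · rw [if_neg hr]
    have hne : (L : ℤ) • q + boxVec L r ≠ 0 := by
      intro h0
      apply hr
      apply (boxVec_eq_zero_iff hL r).1
      funext i
      have hi := congrFun h0 i
      simp only [Pi.add_apply, Pi.smul_apply, smul_eq_mul, Pi.zero_apply] at hi
      have := hq0 i; have := hr0 i
      have hLpos : (0 : ℤ) < L := by exact_mod_cast (by omega : 0 < L)
      simp only [Pi.zero_apply]
      nlinarith [mul_nonneg hLpos.le (hq0 i)]
    rw [if_neg hne]

/-- **ONE TRANSPORTED BLOCK MEAN OF A FINER-LATTICE SPIKE**: `bmeanW L W (spikeW (L·P) h) z = L^{−d} • spikeW P h z` (the only non-zero offset is the block corner, transported by the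
empty word). [folklore] -/
theorem bmeanW_spikeW_mul {L P : ℕ} (hL : 1 ≤ L) (hP : 1 ≤ P) (W : Site d → Fin d → (Matrix n n ℂ)ˣ) (h : Site d → Matrix n n ℂ) (z : Site d) :
    bmeanW L W (spikeW (L * P) h) z = (((L : ℝ) ^ d)⁻¹ : ℝ) • spikeW P h z := by
  unfold bmeanW
  rw [Finset.sum_eq_single (r0 hL)]
  · rw [spikeW_mul_block hL hP, if_pos rfl, boxVec_r0 hL, treeWord_zero, hol_nil, Ad_one]
  · intro r _ hr
    rw [spikeW_mul_block hL hP, if_neg hr, Ad_zero, smul_zero]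
  · intro h0; exact absurd (Finset.mem_univ _) h0

/-- **THE NESTED TRANSPORTED BLOCK MEAN OF A TOP-CORNER SPIKE**: `bmeanIterW L k W (spikeW (L^k) h) z = (L^{−d})^k • h z` for `1 ≤ L` — at every level the spike sits at a block corner and
is transported by the empty word; EXACT at every (curved) background. [folklore] -/
theorem bmeanIterW_spikeW_pow {L : ℕ} (hL : 1 ≤ L) (h : Site d → Matrix n n ℂ) :
    ∀ (k : ℕ) (W : Site d → Fin d → (Matrix n n ℂ)ˣ) (c : ℝ) (z : Site d),
      bmeanIterW L k W (spikeW (L ^ k) (fun y => c • h y)) z = ((((L : ℝ) ^ d)⁻¹) ^ k * c) • h z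
  | 0, W, c, z => by rw [bmeanIterW_zero, pow_zero, spikeW_one, pow_zero, one_mul]
  | k + 1, W, c, z => by
      have hLk : 1 ≤ L ^ k := Nat.one_le_pow k L (by omega)
      rw [bmeanIterW_succ]
      have e : bmeanW L W (spikeW (L ^ (k + 1)) (fun y => c • h y)) = spikeW (L ^ k) (fun y => ((((L : ℝ) ^ d)⁻¹) * c) • h y) := by
        funext y
        rw [pow_succ', bmeanW_spikeW_mul hL hLk, spikeW_smul, spikeW_smul, smul_smul]
      rw [e, bmeanIterW_spikeW_pow hL h k (cavg L W) ((((L : ℝ) ^ d)⁻¹) * c) z, pow_succ]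
      congr 1; ring

/-! ## §2 The top dictionary of the spike gauge direction -/

omit [Fintype n] [DecidableEq n] in
/-- The tower period is `L^m·N`. [folklore] -/
theorem natCast_tower_eq_pow_mul (L N : ℕ) : ∀ m : ℕ, ((tower L N m : ℕ) : ℤ) = ((L ^ m * N : ℕ) : ℤ)
  | 0 => by simp [tower]
  | m + 1 => by
      rw [tower]; push_cast; rw [natCast_tower_eq_pow_mul L N m]; push_cast; ring

/-- `gaugeDir` is additive in the generator, subtraction form. [folklore] -/
theorem gaugeDir_sub_fun (W : Site d → Fin d → (Matrix n n ℂ)ˣ) (lam mu : Site d → Matrix n n ℂ) (z : Site d) (κ : Fin d) :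
    gaugeDir W lam z κ - gaugeDir W mu z κ = gaugeDir W (fun x => lam x - mu x) z κ := by
  simp only [gaugeDir, Ad, Matrix.mul_sub, Matrix.sub_mul]
  abel

/-- `gaugeDir` is homogeneous in the generator (real scalars). [folklore] -/
theorem gaugeDir_smul_fun (W : Site d → Fin d → (Matrix n n ℂ)ˣ) (c : ℝ) (lam : Site d → Matrix n n ℂ) (z : Site d) (κ : Fin d) :
    gaugeDir W (fun x => c • lam x) z κ = c • gaugeDir W lam z κ := by
  simp only [gaugeDir, Ad, Matrix.mul_smul, Matrix.smul_mul, smul_sub]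

/-- **THE ACCUMULATED FRAME READING OF A TOP-CORNER SPIKE GAUGE DIRECTION**: in the multi-level small-field class at a unitary `W` of period `tower L N (j+1) = L^{j+1}·N` (`0 ≤ x`,
`LevelSmall d L j x`, `SmallField W x`), for skew `N`-periodic heights `h` and `M = L^{j+1}`:
`framePotW L (j+1) W (gaugeDir W (spikeW M h)) z = (1 − (L^{−d})^{j+1})•h z` — EXACTLY; no cross-corner terms. [folklore] -/
theorem framePotW_gaugeDir_spikeW [Nonempty n] {L N : ℕ} [NeZero N] (hL : 1 ≤ L) (j : ℕ) {W : Site d → Fin d → (Matrix n n ℂ)ˣ} {x : ℝ}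
    (hWu : IsUnitaryCfg W) (hWP : IsPeriodicCfg W ((tower L N (j + 1) : ℕ) : ℤ)) (hx : 0 ≤ x) (hs : LevelSmall d L j x) (hWx : SmallField W x)
    {h : Site d → Matrix n n ℂ} (hh : ∀ z, h z ∈ skewAdjoint (Matrix n n ℂ)) (hhP : ∀ (z : Site d) (τ : Fin d), h (z + (N : ℤ) • e τ) = h z) (z : Site d) :
    framePotW L (j + 1) W (gaugeDir W (spikeW (L ^ (j + 1)) h)) z = (1 - (((L : ℝ) ^ d)⁻¹) ^ (j + 1)) • h z := by
  have hM : 1 ≤ L ^ (j + 1) := Nat.one_le_pow _ L (by omega)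
  have hμ : ∀ y, spikeW (L ^ (j + 1)) h y ∈ skewAdjoint (Matrix n n ℂ) := spikeW_mem_skewAdjoint _ hh
  have hμP : ∀ (y : Site d) (i : Fin d), spikeW (L ^ (j + 1)) h (y + ((tower L N (j + 1) : ℕ) : ℤ) • e i) = spikeW (L ^ (j + 1)) h y := by
    intro y i; rw [natCast_tower_eq_pow_mul]; exact spikeW_add_period hM hhP y i
  have h1 := framePotW_gaugeDir (M := N) hL j hWu hWP hx hs hWx hμ hμP z
  have e1 : spikeW (L ^ (j + 1)) h (((L : ℤ) ^ (j + 1)) • z) = h z := by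
    have : (((L : ℤ) ^ (j + 1)) • z : Site d) = ((L ^ (j + 1) : ℕ) : ℤ) • z := by push_cast; rfl
    rw [this, spikeW_corner hM]
  have e2 : bmeanIterW L (j + 1) W (spikeW (L ^ (j + 1)) h) z = ((((L : ℝ) ^ d)⁻¹) ^ (j + 1)) • h z := by
    have h2 := bmeanIterW_spikeW_pow hL h (j + 1) W 1 z
    have e : (fun y => (1 : ℝ) • h y) = h := funext fun y => one_smul _ _
    rw [e, mul_one] at h2
    exact h2
  rw [h1, e1, e2, sub_smul, one_smul]

/-- **THE k-FOLD LINEARISED AVERAGE OF A TOP-CORNER SPIKE GAUGE DIRECTION IS THE TOP GAUGE DIRECTION OF THE HEIGHTS**: same class,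
`dirIter L (j+1) W (gaugeDir W (spikeW M h)) = gaugeDir (cavgIter L (j+1) W) h`. [folklore] -/
theorem dirIter_gaugeDir_spikeW [Nonempty n] {L N : ℕ} [NeZero N] (hL : 1 ≤ L) (j : ℕ) {W : Site d → Fin d → (Matrix n n ℂ)ˣ} {x : ℝ}
    (hWu : IsUnitaryCfg W) (hWP : IsPeriodicCfg W ((tower L N (j + 1) : ℕ) : ℤ)) (hx : 0 ≤ x) (hs : LevelSmall d L j x) (hWx : SmallField W x)
    {h : Site d → Matrix n n ℂ} (hh : ∀ z, h z ∈ skewAdjoint (Matrix n n ℂ)) (hhP : ∀ (z : Site d) (τ : Fin d), h (z + (N : ℤ) • e τ) = h z) :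
    dirIter L (j + 1) W (gaugeDir W (spikeW (L ^ (j + 1)) h)) = gaugeDir (cavgIter L (j + 1) W) h := by
  have hM : 1 ≤ L ^ (j + 1) := Nat.one_le_pow _ L (by omega)
  have hμ : ∀ y, spikeW (L ^ (j + 1)) h y ∈ skewAdjoint (Matrix n n ℂ) := spikeW_mem_skewAdjoint _ hh
  have hμP : ∀ (y : Site d) (i : Fin d), spikeW (L ^ (j + 1)) h (y + ((tower L N (j + 1) : ℕ) : ℤ) • e i) = spikeW (L ^ (j + 1)) h y := by
    intro y i; rw [natCast_tower_eq_pow_mul]; exact spikeW_add_period hM hhP y i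
  rw [dirIter_gaugeDir (M := N) hL j hWu hWP hx hs hWx hμ hμP]
  have e : (fun y => spikeW (L ^ (j + 1)) h (((L : ℤ) ^ (j + 1)) • y)) = h := by
    funext y
    have : (((L : ℤ) ^ (j + 1)) • y : Site d) = ((L ^ (j + 1) : ℕ) : ℤ) • y := by push_cast; rfl
    rw [this, spikeW_corner hM]
  rw [e]

/-- **THE k-FOLD LINEARISED DOUBLE-BAR AVERAGE OF A TOP-CORNER SPIKE GAUGE DIRECTION**: same class,
`QbarIter L (j+1) W (gaugeDir W (spikeW M h)) z κ = gaugeDir (cavgIter L (j+1) W) ((L^{−d})^{j+1}•h) z κ` — the nested block-mean pure gauge, `M^{−d}`-small. [folklore] -/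
theorem QbarIter_gaugeDir_spikeW [Nonempty n] {L N : ℕ} [NeZero N] (hL : 1 ≤ L) (j : ℕ) {W : Site d → Fin d → (Matrix n n ℂ)ˣ} {x : ℝ}
    (hWu : IsUnitaryCfg W) (hWP : IsPeriodicCfg W ((tower L N (j + 1) : ℕ) : ℤ)) (hx : 0 ≤ x) (hs : LevelSmall d L j x) (hWx : SmallField W x)
    {h : Site d → Matrix n n ℂ} (hh : ∀ z, h z ∈ skewAdjoint (Matrix n n ℂ)) (hhP : ∀ (z : Site d) (τ : Fin d), h (z + (N : ℤ) • e τ) = h z)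
    (z : Site d) (κ : Fin d) :
    QbarIter L (j + 1) W (gaugeDir W (spikeW (L ^ (j + 1)) h)) z κ
      = gaugeDir (cavgIter L (j + 1) W) (fun y => ((((L : ℝ) ^ d)⁻¹) ^ (j + 1)) • h y) z κ := by
  have hM : 1 ≤ L ^ (j + 1) := Nat.one_le_pow _ L (by omega)
  have hμ : ∀ y, spikeW (L ^ (j + 1)) h y ∈ skewAdjoint (Matrix n n ℂ) := spikeW_mem_skewAdjoint _ hh
  have hμP : ∀ (y : Site d) (i : Fin d), spikeW (L ^ (j + 1)) h (y + ((tower L N (j + 1) : ℕ) : ℤ) • e i) = spikeW (L ^ (j + 1)) h y := by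
    intro y i; rw [natCast_tower_eq_pow_mul]; exact spikeW_add_period hM hhP y i
  have h1 := QbarIter_gaugeDir (M := N) hL j hWu hWP hx hs hWx hμ hμP
  rw [h1]
  have e : (fun y => spikeW (L ^ (j + 1)) h (((L : ℤ) ^ (j + 1)) • y)) = h := by
    funext y
    have : (((L : ℤ) ^ (j + 1)) • y : Site d) = ((L ^ (j + 1) : ℕ) : ℤ) • y := by push_cast; rfl
    rw [this, spikeW_corner hM]
  have e2 : framePotW L (j + 1) W (gaugeDir W (spikeW (L ^ (j + 1)) h)) = fun y => (1 - (((L : ℝ) ^ d)⁻¹) ^ (j + 1)) • h y :=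
    funext fun y => framePotW_gaugeDir_spikeW hL j hWu hWP hx hs hWx hh hhP y
  show gaugeDir (cavgIter L (j + 1) W) (fun y => spikeW (L ^ (j + 1)) h (((L : ℤ) ^ (j + 1)) • y)) z κ
      - gaugeDir (cavgIter L (j + 1) W) (framePotW L (j + 1) W (gaugeDir W (spikeW (L ^ (j + 1)) h))) z κ = _
  rw [e, e2, gaugeDir_sub_fun]
  have e3 : (fun y => h y - (1 - (((L : ℝ) ^ d)⁻¹) ^ (j + 1)) • h y) = fun y => ((((L : ℝ) ^ d)⁻¹) ^ (j + 1)) • h y := by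
    funext y; rw [sub_smul, one_smul, sub_sub_cancel]
  rw [e3]

/-! ## §3 The letters of the spike gauge direction -/

/-- **THE ℓ² LETTER** (row NE3 by name): for `M, N ≥ 1`, a unitary `W` and `N`-periodic heights, `dirSq (gaugeDir W (spikeW M h)) [0,M·N)^d ≤ 4d·Σ_{z∈[0,N)^d}‖h z‖²` — each spike
touches `2d` bonds; with the weight `M⁻²` of `energyNormW` this is the `M⁻²`-discounted cost of the corner spikes. [folklore] -/
theorem dirSq_gaugeDir_spikeW_le [Nonempty n] {M N : ℕ} (hM : 1 ≤ M) (hN : 1 ≤ N) {W : Site d → Fin d → (Matrix n n ℂ)ˣ} (hW : IsUnitaryCfg W)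
    {h : Site d → Matrix n n ℂ} (hhP : ∀ (z : Site d) (τ : Fin d), h (z + (N : ℤ) • e τ) = h z) :
    dirSq (gaugeDir W (spikeW M h)) (periodBox (d := d) (M * N)) ≤ 4 * (d : ℝ) * ∑ z ∈ periodBox (d := d) N, ‖h z‖ ^ 2 :=
  sum_normSq_gaugeDir_spikeW_le hM hN hW hhP

/-- **THE CURL LETTER**: for `M ≥ 1`, a unitary `W` with `SmallField W a`, `curlSq W (gaugeDir W (spikeW M h)) [0,M·N)^d ≤ 4a²·#Plane·Σ_{z∈[0,N)^d}‖h z‖²` (the linearised curl of a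
gauge direction is the commutator with the plaquette, `NE3CurlOfGaugeDir.curlSq_gaugeDir_le`; the spike field's mass over one period is `Σ‖h‖²`). [folklore] -/
theorem curlSq_gaugeDir_spikeW_le [Nonempty n] {M : ℕ} (hM : 1 ≤ M) (N : ℕ) {W : Site d → Fin d → (Matrix n n ℂ)ˣ} (hW : IsUnitaryCfg W) {a : ℝ}
    (hWa : SmallField W a) (h : Site d → Matrix n n ℂ) :
    curlSq W (gaugeDir W (spikeW M h)) (periodBox (d := d) (M * N))
      ≤ 4 * a ^ 2 * (Fintype.card (T4AveragingDeficitWall.Plane d)) * ∑ z ∈ periodBox (d := d) N, ‖h z‖ ^ 2 := by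
  have h1 := curlSq_gaugeDir_le hW hWa (spikeW M h) (periodBox (d := d) (M * N))
  have hS : ∑ y ∈ periodBox (d := d) (M * N), ‖spikeW M h y‖ ^ 2 = ∑ z ∈ periodBox (d := d) N, ‖h z‖ ^ 2 := by
    rw [← sum_periodBox_blocks M N hM]
    exact Finset.sum_congr rfl fun z _ => sum_block_normSq_spikeW hM h z
  rw [hS] at h1
  exact h1

end

end Summit.QuantumFields.BalabanUV.T4Continuum.NE7CornerSpikeTopDictionary
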